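import Literature.Probability.Percolation.CardyFormula
import Literature.Probability.Percolation.QuadCrossingRotationInvariance
import Literature.Probability.LatticeModels.MeshApproximatesPolyomino
import Summits.CriticalPhenomena.CardyFormulaZ2.Theorems.CardyUSTContinuationKirchhoffExtremalLengthG02MissingEdge

/-!
# Stub `stub_dilationEquicontinuity` of the birth skeleton of the crux `PolyominoGaussianLaw`
# (stmt-CriticalPhenomena-14337, route `CardyTensorRG`) — Part 1: lattice geometry

Deterministic lattice facts used by the Schramm–Smirnov sandwich of the dilation-equicontinuity
stub (Parts 2–4 and the final file):

* polyomino domains (interiors of finite unions of closed `a`-squares with corners on `aℤ²`,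
  the class of the crux) are translates by `(a/2)(1+i)` of the tree's `meshPolygon Λ a`
  (`dl_mem_cornerPolyomino_iff`), scale to polyomino domains (`dl_image_mul_cornerPolyomino`),
  and **no axis-parallel segment of length `< a` with both ends in the domain leaves it**
  (`dl_segment_subset_meshPolygon_re/_im`, `dl_segment_subset_of_adj`);
* generalities on H21's discretisation `DomainDiscretisation.lean` (the largest mesh component is
  closed under mesh-graph adjacency: `KirchhoffSlope.mem_meshDomain_of_meshGraph_adj`, reused from
  `CardyUSTContinuationKirchhoffExtremalLengthG02MissingEdge.lean`): discrete boundary vertices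
  are within one mesh of the frontier (`dl_exists_frontier_near_of_mem_meshBoundary`), vertices of
  a discrete arc are within one mesh of the arc (`dl_infDist_le_of_mem_discreteArc`), an open
  `Ω_δ`-path draws a continuous path inside `closure Ω ∩ openEdgeUnion δ ω`
  (`dl_joinedIn_of_walk`);
(The exact behaviour of the discretisation under dilations is in Part 3.)

All [folklore].
-/

noncomputable section

open Set Metric Complex
open Literature.Probability.LatticeModels Literature.Probability.Percolation

namespace Summit.CriticalPhenomena.CardyFormulaZ2.Cruxes.PolyominoGaussianLaw.Birth

/-! ### Polyomino domains: short axis-parallel segments do not leave the domain -/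

section Polyomino

open Literature.Probability.LatticeModels.Polyomino

variable {a : ℝ} {Λ : Set (Site 2)}

/-- **Horizontal gap lemma.** In a polyomino domain `meshPolygon Λ a` (interior of the union of the
closed `a`-cells centred at `aΛ`), a horizontal segment of length `d < a` whose two ends lie in the
domain lies in the domain: a point of the segment off the domain would lie in a closed cell off `Λ`
(`not_mem_meshPolygon_iff`), which contains neither end, and the two ends would then be more than
`a` apart. [folklore] -/
theorem dl_segment_subset_meshPolygon_re (ha : 0 < a) {u : ℂ} {d : ℝ} (hd0 : 0 ≤ d) (hda : d < a)
    (hu : u ∈ meshPolygon Λ a) (hv : u + (d : ℂ) ∈ meshPolygon Λ a) :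
    segment ℝ u (u + (d : ℂ)) ⊆ meshPolygon Λ a := by
  intro q hq
  by_contra hqP
  obtain ⟨c, hc, hqc⟩ := (not_mem_meshPolygon_iff ha).1 hqP
  have huc : u ∉ meshCell a c := fun h => (meshCell_disjoint_meshPolygon ha hc).le_bot ⟨h, hu⟩
  have hvc : u + (d : ℂ) ∉ meshCell a c := fun h =>
    (meshCell_disjoint_meshPolygon ha hc).le_bot ⟨h, hv⟩
  obtain ⟨θ, hθ0, hθ1, rfl⟩ : ∃ θ : ℝ, 0 ≤ θ ∧ θ ≤ 1 ∧ u + (θ : ℂ) * (d : ℂ) = q := by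
    rw [segment_eq_image'] at hq
    obtain ⟨θ, ⟨h0, h1⟩, rfl⟩ := hq
    exact ⟨θ, h0, h1, by simp [Complex.real_smul]⟩
  rw [mem_meshCell_iff] at hqc huc hvc
  have hre : (u + (θ : ℂ) * (d : ℂ)).re = u.re + θ * d := by simp
  have him : (u + (θ : ℂ) * (d : ℂ)).im = u.im := by simp
  have hre' : (u + (d : ℂ)).re = u.re + d := by simp
  have him' : (u + (d : ℂ)).im = u.im := by simp
  rw [hre, him] at hqc
  rw [hre', him'] at hvc
  rw [not_and_or, not_le, not_le] at huc hvc
  obtain ⟨hq0, hq1⟩ := hqc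
  rw [abs_le] at hq0
  have hθd : θ * d ≤ d := by nlinarith
  have hθd0 : 0 ≤ θ * d := by positivity
  rcases huc with huc | huc
  · rcases hvc with hvc | hvc
    · rw [lt_abs] at huc hvc
      rcases huc with huc | huc
      · linarith
      · rcases hvc with hvc | hvc
        · linarith
        · linarith
    · exact absurd hq1 (not_le.2 hvc)
  · exact absurd hq1 (not_le.2 huc)

/-- **Vertical gap lemma** (the horizontal one with the coordinates exchanged). [folklore] -/
theorem dl_segment_subset_meshPolygon_im (ha : 0 < a) {u : ℂ} {d : ℝ} (hd0 : 0 ≤ d) (hda : d < a)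
    (hu : u ∈ meshPolygon Λ a) (hv : u + (d : ℂ) * Complex.I ∈ meshPolygon Λ a) :
    segment ℝ u (u + (d : ℂ) * Complex.I) ⊆ meshPolygon Λ a := by
  intro q hq
  by_contra hqP
  obtain ⟨c, hc, hqc⟩ := (not_mem_meshPolygon_iff ha).1 hqP
  have huc : u ∉ meshCell a c := fun h => (meshCell_disjoint_meshPolygon ha hc).le_bot ⟨h, hu⟩
  have hvc : u + (d : ℂ) * Complex.I ∉ meshCell a c := fun h =>
    (meshCell_disjoint_meshPolygon ha hc).le_bot ⟨h, hv⟩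
  obtain ⟨θ, hθ0, hθ1, rfl⟩ : ∃ θ : ℝ, 0 ≤ θ ∧ θ ≤ 1 ∧ u + (θ : ℂ) * ((d : ℂ) * Complex.I) = q := by
    rw [segment_eq_image'] at hq
    obtain ⟨θ, ⟨h0, h1⟩, rfl⟩ := hq
    exact ⟨θ, h0, h1, by simp [Complex.real_smul]⟩
  rw [mem_meshCell_iff] at hqc huc hvc
  have hre : (u + (θ : ℂ) * ((d : ℂ) * Complex.I)).re = u.re := by simp
  have him : (u + (θ : ℂ) * ((d : ℂ) * Complex.I)).im = u.im + θ * d := by simp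
  have hre' : (u + (d : ℂ) * Complex.I).re = u.re := by simp
  have him' : (u + (d : ℂ) * Complex.I).im = u.im + d := by simp
  rw [hre, him] at hqc
  rw [hre', him'] at hvc
  rw [not_and_or, not_le, not_le] at huc hvc
  obtain ⟨hq0, hq1⟩ := hqc
  rw [abs_le] at hq1
  have hθd : θ * d ≤ d := by nlinarith
  have hθd0 : 0 ≤ θ * d := by positivity
  rcases huc with huc | huc
  · exact absurd hq0 (not_le.2 huc)
  · rcases hvc with hvc | hvc
    · exact absurd hq0 (not_le.2 hvc)
    · rw [lt_abs] at huc hvc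
      rcases huc with huc | huc
      · linarith
      · rcases hvc with hvc | hvc
        · linarith
        · linarith

/-- The mesh point of `x + e₀` is the mesh point of `x` moved by `δ`. [folklore] -/
theorem dl_meshPoint_add_single_zero (δ : ℝ) (x : Site 2) :
    meshPoint δ (x + Pi.single 0 1) = meshPoint δ x + (δ : ℂ) := by
  apply Complex.ext
  · rw [meshPoint_re, Complex.add_re, meshPoint_re, Complex.ofReal_re, add_single_zero_apply_zero]
    push_cast; ring
  · rw [meshPoint_im, Complex.add_im, meshPoint_im, Complex.ofReal_im, add_single_zero_apply_one]
    ring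

/-- The mesh point of `x + e₁` is the mesh point of `x` moved by `δ i`. [folklore] -/
theorem dl_meshPoint_add_single_one (δ : ℝ) (x : Site 2) :
    meshPoint δ (x + Pi.single 1 1) = meshPoint δ x + (δ : ℂ) * Complex.I := by
  apply Complex.ext
  · rw [meshPoint_re, Complex.add_re, meshPoint_re, add_single_one_apply_zero]
    simp
  · rw [meshPoint_im, Complex.add_im, meshPoint_im, add_single_one_apply_one]
    simp only [Int.cast_add, Int.cast_one, Complex.mul_im, Complex.ofReal_re, Complex.I_im,
      mul_one, Complex.ofReal_im, Complex.I_re, mul_zero, add_zero]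
    ring

/-- **No lattice bond of a (translated) polyomino domain leaves it** (fine mesh `0 < δ < a`): if
`Ω` is the translate by `τ` of `meshPolygon Λ a` and two `ℤ²`-adjacent fine sites have their mesh
points in `Ω`, then the closed bond between them lies in `Ω`. [folklore] -/
theorem dl_segment_subset_of_adj (ha : 0 < a) {δ : ℝ} (hδ : 0 < δ) (hδa : δ < a) (τ : ℂ)
    {Ω : Set ℂ} (hΩ : ∀ z, z ∈ Ω ↔ z - τ ∈ meshPolygon Λ a) {x y : Site 2}
    (hxy : (zdGraph 2).Adj x y) (hx : meshPoint δ x ∈ Ω) (hy : meshPoint δ y ∈ Ω) :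
    segment ℝ (meshPoint δ x) (meshPoint δ y) ⊆ Ω := by
  -- reduce to `y = x + eᵢ`
  wlog h : ∃ i, y = x + Pi.single i 1 generalizing x y
  · obtain ⟨i, h' | h'⟩ := (zdGraph_adj_iff x y).1 hxy
    · exact (h ⟨i, h'⟩).elim
    · rw [segment_symm]
      exact this hxy.symm hy hx ⟨i, h'⟩
  obtain ⟨i, rfl⟩ := h
  -- translate back to the polygon
  have key : ∀ v : ℂ, meshPoint δ x + v ∈ Ω →
      segment ℝ (meshPoint δ x - τ) (meshPoint δ x - τ + v) ⊆ meshPolygon Λ a →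
      segment ℝ (meshPoint δ x) (meshPoint δ x + v) ⊆ Ω := by
    intro v _ hseg q hq
    rw [hΩ]
    apply hseg
    have himg := segment_translate_image ℝ (-τ) (meshPoint δ x) (meshPoint δ x + v)
    have hq' : -τ + q ∈ (fun z => -τ + z) '' segment ℝ (meshPoint δ x) (meshPoint δ x + v) :=
      ⟨q, hq, rfl⟩
    rw [himg, show -τ + q = q - τ by ring, show -τ + meshPoint δ x = meshPoint δ x - τ by ring,
      show -τ + (meshPoint δ x + v) = meshPoint δ x - τ + v by ring] at hq'
    exact hq'
  have hx' : meshPoint δ x - τ ∈ meshPolygon Λ a := (hΩ _).1 hx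
  fin_cases i
  · change meshPoint δ (x + Pi.single 0 1) ∈ Ω at hy
    change segment ℝ (meshPoint δ x) (meshPoint δ (x + Pi.single 0 1)) ⊆ Ω
    rw [dl_meshPoint_add_single_zero] at hy ⊢
    refine key _ hy ?_
    have hv' : meshPoint δ x - τ + (δ : ℂ) ∈ meshPolygon Λ a := by
      have := (hΩ _).1 hy
      convert this using 1
      ring
    exact dl_segment_subset_meshPolygon_re ha hδ.le hδa hx' hv'
  · change meshPoint δ (x + Pi.single 1 1) ∈ Ω at hy
    change segment ℝ (meshPoint δ x) (meshPoint δ (x + Pi.single 1 1)) ⊆ Ω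
    rw [dl_meshPoint_add_single_one] at hy ⊢
    refine key _ hy ?_
    have hv' : meshPoint δ x - τ + (δ : ℂ) * Complex.I ∈ meshPolygon Λ a := by
      have := (hΩ _).1 hy
      convert this using 1
      ring
    exact dl_segment_subset_meshPolygon_im ha hδ.le hδa hx' hv'

/-- **The polyomino domains of the crux are translated `meshPolygon`s.** The interior of the union
of the closed `a`-squares `[a p₁, a p₁ + a] × [a p₂, a p₂ + a]`, `p ∈ s`, is the translate by
`(a/2)(1 + i)` of `meshPolygon Λ a` for `Λ = {x | (x 0, x 1) ∈ s}`. [folklore] -/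
theorem dl_mem_cornerPolyomino_iff (a : ℝ) (s : Finset (ℤ × ℤ)) (z : ℂ) :
    z ∈ interior (⋃ p ∈ s, {z : ℂ | a * (p.1 : ℝ) ≤ z.re ∧ z.re ≤ a * ((p.1 : ℝ) + 1) ∧
        a * (p.2 : ℝ) ≤ z.im ∧ z.im ≤ a * ((p.2 : ℝ) + 1)}) ↔
      z - ((a / 2 : ℝ) : ℂ) * (1 + Complex.I) ∈ meshPolygon {x : Site 2 | (x 0, x 1) ∈ s} a := by
  set τ : ℂ := ((a / 2 : ℝ) : ℂ) * (1 + Complex.I) with hτ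
  have hτre : τ.re = a / 2 := by simp [hτ]
  have hτim : τ.im = a / 2 := by simp [hτ]
  set U : Set ℂ := ⋃ p ∈ s, {z : ℂ | a * (p.1 : ℝ) ≤ z.re ∧ z.re ≤ a * ((p.1 : ℝ) + 1) ∧
        a * (p.2 : ℝ) ≤ z.im ∧ z.im ≤ a * ((p.2 : ℝ) + 1)} with hU
  set Λ : Set (Site 2) := {x : Site 2 | (x 0, x 1) ∈ s} with hΛ
  -- the union of corner squares is the translate of the union of centred cells
  have hcell : ∀ w : ℂ, w ∈ U ↔ w - τ ∈ ⋃ x ∈ Λ, meshCell a x := by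
    intro w
    simp only [hU, mem_iUnion, mem_setOf_eq, exists_prop]
    constructor
    · rintro ⟨p, hp, h1, h2, h3, h4⟩
      refine ⟨![p.1, p.2], by simpa [hΛ] using hp, ?_⟩
      rw [mem_meshCell_iff, Complex.sub_re, Complex.sub_im, hτre, hτim]
      simp only [Matrix.cons_val_zero, Matrix.cons_val_one]
      exact ⟨abs_le.2 ⟨by linarith, by linarith⟩, abs_le.2 ⟨by linarith, by linarith⟩⟩
    · rintro ⟨x, hx, hw⟩
      rw [mem_meshCell_iff, Complex.sub_re, Complex.sub_im, hτre, hτim] at hw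
      obtain ⟨h1, h2⟩ := hw
      rw [abs_le] at h1 h2
      refine ⟨(x 0, x 1), hx, ?_, ?_, ?_, ?_⟩ <;> push_cast <;> linarith
  have hsymm : ∀ w : ℂ, (Homeomorph.addRight τ).symm w = w - τ := fun w => by
    rw [Homeomorph.addRight_symm, Homeomorph.coe_addRight, sub_eq_add_neg]
  have hUeq : U = (Homeomorph.addRight τ) '' ⋃ x ∈ Λ, meshCell a x := by
    ext w
    rw [hcell, Homeomorph.image_eq_preimage_symm, mem_preimage, hsymm]
  show z ∈ interior U ↔ z - τ ∈ meshPolygon Λ a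
  rw [hUeq, ← Homeomorph.image_interior, Homeomorph.image_eq_preimage_symm, mem_preimage, meshPolygon,
    hsymm]

/-- **Dilates of polyomino domains are polyomino domains**: `t · interior (⋃ squares of side a)`
is the interior of the union of the squares of side `t a` with the same indices (`t > 0`).
[folklore] -/
theorem dl_image_mul_cornerPolyomino {a t : ℝ} (ht : 0 < t) (s : Finset (ℤ × ℤ)) :
    (fun z : ℂ => (t : ℂ) * z) '' interior (⋃ p ∈ s, {z : ℂ | a * (p.1 : ℝ) ≤ z.re ∧
        z.re ≤ a * ((p.1 : ℝ) + 1) ∧ a * (p.2 : ℝ) ≤ z.im ∧ z.im ≤ a * ((p.2 : ℝ) + 1)}) =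
      interior (⋃ p ∈ s, {z : ℂ | t * a * (p.1 : ℝ) ≤ z.re ∧ z.re ≤ t * a * ((p.1 : ℝ) + 1) ∧
        t * a * (p.2 : ℝ) ≤ z.im ∧ z.im ≤ t * a * ((p.2 : ℝ) + 1)}) := by
  have ht' : (t : ℂ) ≠ 0 := by exact_mod_cast ht.ne'
  have hM : (fun z : ℂ => (t : ℂ) * z) = ⇑(Homeomorph.mulLeft₀ (t : ℂ) ht') :=
    (Homeomorph.coe_mulLeft₀ (t : ℂ) ht').symm
  rw [hM, (Homeomorph.mulLeft₀ (t : ℂ) ht').image_interior, ← hM]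
  congr 1
  rw [image_iUnion₂]
  refine iUnion₂_congr fun p _ => ?_
  ext w
  simp only [mem_image, mem_setOf_eq]
  constructor
  · rintro ⟨z, ⟨h1, h2, h3, h4⟩, rfl⟩
    simp only [Complex.mul_re, Complex.mul_im, Complex.ofReal_re, Complex.ofReal_im, zero_mul,
      sub_zero, add_zero]
    refine ⟨by nlinarith, by nlinarith, by nlinarith, by nlinarith⟩
  · rintro ⟨h1, h2, h3, h4⟩
    have hre : (((t⁻¹ : ℝ) : ℂ) * w).re = t⁻¹ * w.re := Complex.re_ofReal_mul _ _
    have him : (((t⁻¹ : ℝ) : ℂ) * w).im = t⁻¹ * w.im := Complex.im_ofReal_mul _ _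
    have e1 : t⁻¹ * w.re = w.re / t := by rw [div_eq_inv_mul]
    have e2 : t⁻¹ * w.im = w.im / t := by rw [div_eq_inv_mul]
    refine ⟨((t⁻¹ : ℝ) : ℂ) * w, ⟨?_, ?_, ?_, ?_⟩, ?_⟩
    · rw [hre, e1, le_div_iff₀ ht]; linarith
    · rw [hre, e1, div_le_iff₀ ht]; linarith
    · rw [him, e2, le_div_iff₀ ht]; linarith
    · rw [him, e2, div_le_iff₀ ht]; linarith
    · rw [← mul_assoc, ← Complex.ofReal_mul, mul_inv_cancel₀ ht.ne', Complex.ofReal_one, one_mul]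

end Polyomino

/-! ### Generalities on the discretisation -/

section Discretisation

variable {Ω : Set ℂ} {δ : ℝ}

/-- **Discrete boundary vertices are within one mesh of the frontier** (`Ω` open, `δ ≥ 0`): a
vertex of `∂Ω_δ` has a lattice neighbour not joined to it in `Ω_δ`, so the bond towards it leaves
`Ω` (it leaves `closure Ω`, or its end is off `Ω` — an end inside `Ω` joined by a bond in
`closure Ω` would lie in the same, largest, component), and meets `frontier Ω`. [folklore] -/
theorem dl_exists_frontier_near_of_mem_meshBoundary (hΩ : IsOpen Ω) (hδ : 0 ≤ δ) {x : Site 2}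
    (hx : x ∈ meshBoundary Ω δ) : ∃ b ∈ frontier Ω, dist (meshPoint δ x) b ≤ δ := by
  obtain ⟨hxD, y, hxy, hny⟩ := mem_meshBoundary_iff'.1 hx
  have hxΩ : meshPoint δ x ∈ Ω := meshDomain_subset_meshVertices _ _ hxD
  -- some point of the bond `[δx, δy]` is off `Ω`
  have hseg : ∃ z ∈ segment ℝ (meshPoint δ x) (meshPoint δ y), z ∉ Ω := by
    have hnot : ¬ (meshGraph Ω δ).Adj x y →
        ∃ z ∈ segment ℝ (meshPoint δ x) (meshPoint δ y), z ∉ Ω := by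
      intro h
      rw [meshGraph_adj_iff, not_and] at h
      obtain ⟨z, hz, hzc⟩ := not_subset.1 (h hxy)
      exact ⟨z, hz, fun hzΩ => hzc (subset_closure hzΩ)⟩
    rcases hny with hny | hny
    · by_cases hyV : y ∈ meshVertices Ω δ
      · by_cases hadj : (meshGraph Ω δ).Adj x y
        · exact absurd (Summit.CriticalPhenomena.CardyFormulaZ2.Theorems.KirchhoffSlope.mem_meshDomain_of_meshGraph_adj hxD hyV hadj) hny
        · exact hnot hadj
      · exact ⟨meshPoint δ y, right_mem_segment _ _ _, hyV⟩
    · exact hnot hny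
  obtain ⟨z, hz, hzΩ⟩ := hseg
  obtain ⟨b, hb, hbf⟩ := Polyomino.exists_mem_segment_mem_frontier hΩ hxΩ hzΩ
  refine ⟨b, hbf, ?_⟩
  rw [dist_comm, dist_eq_norm]
  calc ‖b - meshPoint δ x‖ ≤ ‖z - meshPoint δ x‖ := norm_sub_le_of_mem_segment hb
    _ ≤ ‖meshPoint δ y - meshPoint δ x‖ := norm_sub_le_of_mem_segment hz
    _ = dist (meshPoint δ y) (meshPoint δ x) := (dist_eq_norm _ _).symm
    _ ≤ δ := Polyomino.dist_meshPoint_le_of_adj hδ hxy.symm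

/-- **Vertices of a discrete arc are within one mesh of the arc** (`Ω` open, `δ ≥ 0`,
`A ⊆ frontier Ω` not needed): the frontier point near a discrete-arc vertex is either on `A` or on
`frontier Ω ∖ A`, and in the latter case the defining comparison of `discreteArc` applies.
[folklore] -/
theorem dl_infDist_le_of_mem_discreteArc (hΩ : IsOpen Ω) (hδ : 0 ≤ δ) {A : Set ℂ} {x : Site 2}
    (hx : x ∈ discreteArc Ω δ A) : infDist (meshPoint δ x) A ≤ δ := by
  obtain ⟨hxB, hle⟩ := mem_discreteArc_iff.1 hx
  obtain ⟨b, hb, hdist⟩ := dl_exists_frontier_near_of_mem_meshBoundary hΩ hδ hxB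
  by_cases hbA : b ∈ A
  · exact (infDist_le_dist_of_mem hbA).trans hdist
  · exact hle.trans ((infDist_le_dist_of_mem (mem_sdiff_of_mem hb hbA)).trans hdist)

/-- **An open `Ω_δ`-path draws a continuous path** inside `closure Ω ∩ openEdgeUnion δ ω` between
the mesh points of its ends (a walk of positive length: every bond of it is open and its closed
segment lies in `closure Ω`). [folklore] -/
theorem dl_joinedIn_of_walk {ω : BondConfig (Site 2)} {x y : Site 2}
    (W : (openGraph ω ⊓ discreteDomainGraph Ω δ).Walk x y) (hne : x ≠ y) :
    JoinedIn (closure Ω ∩ openEdgeUnion δ ω) (meshPoint δ x) (meshPoint δ y) := by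
  induction W with
  | nil => exact absurd rfl hne
  | @cons u v w h W ih =>
    have hseg : segment ℝ (meshPoint δ u) (meshPoint δ v) ⊆ closure Ω ∩ openEdgeUnion δ ω := by
      obtain ⟨hopen, hdom⟩ := h
      have hω : s(u, v) ∈ ω := ((openGraph_adj ω u v).1 hopen).1
      obtain ⟨hadj, hcl⟩ := meshGraph_adj_iff.1 (discreteDomainGraph_le_meshGraph Ω δ hdom)
      intro q hq
      exact ⟨hcl hq, mem_openEdgeUnion_iff.2 ⟨u, v, hadj, hω, hq⟩⟩
    have J1 : JoinedIn (closure Ω ∩ openEdgeUnion δ ω) (meshPoint δ u) (meshPoint δ v) :=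
      JoinedIn.of_segment_subset hseg
    by_cases hvw : v = w
    · subst hvw; exact J1
    · exact J1.trans (ih hvw)

end Discretisation


/-! ### Registered one-line form -/

/-- **Registered sub-goal `stub_dilationEquicontinuity_part1`** of `stub_dilationEquicontinuity`
(stmt-CriticalPhenomena-14337): the bond property of translated polyomino domains, one-line form of
`dl_segment_subset_of_adj`. [folklore] -/
theorem stub_dilationEquicontinuity_part1 : ∀ (a δ : ℝ) (Λ : Set (Literature.Probability.LatticeModels.Site 2)) (τ : ℂ) (Ω : Set ℂ), 0 < a → 0 < δ → δ < a → (∀ z : ℂ, z ∈ Ω ↔ z - τ ∈ Literature.Probability.LatticeModels.meshPolygon Λ a) → ∀ x y : Literature.Probability.LatticeModels.Site 2, (Literature.Probability.LatticeModels.zdGraph 2).Adj x y → Literature.Probability.LatticeModels.meshPoint δ x ∈ Ω → Literature.Probability.LatticeModels.meshPoint δ y ∈ Ω → segment ℝ (Literature.Probability.LatticeModels.meshPoint δ x) (Literature.Probability.LatticeModels.meshPoint δ y) ⊆ Ω :=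
  fun _ _ _ τ _ ha hδ hδa hΩ _ _ hxy hx hy => dl_segment_subset_of_adj ha hδ hδa τ hΩ hxy hx hy

end Summit.CriticalPhenomena.CardyFormulaZ2.Cruxes.PolyominoGaussianLaw.Birth
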